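import Summits.BirchSwinnertonDyer.BirchSwinnertonDyer.Theorems.ThetaPartnerAtTwoSignedTransportAtTwoLocalProductCount
import Literature.NumberTheory.EllipticCurves.Greenberg1999.LocalTowerKummerVanishingProofs
import Literature.NumberTheory.EllipticCurves.SubgroupSelmerCocycleCriteriaProofs
import Literature.NumberTheory.EllipticCurves.KummerSelmerStructure
import Literature.NumberTheory.EllipticCurves.GeomPointsGaloisModule
import Literature.NumberTheory.EllipticCurves.SelmerCorankProofs
import Literature.NumberTheory.EllipticCurves.IwasawaSelmerControlLocalInputsProofs
import HarnessLib

/-!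
# The two local currencies at `v ∤ p` agree: GV's inertia/decomposition currency
# `H¹(H ∩ D_v, E[p^∞])` (line `bridge`, `Y_v`) INJECTS into Greenberg's `𝒫`-currency
# `𝒫_v = H¹(Gal(K̄_v/(K_∞)_η), E(K̄_v))`, compatibly with the two localisation maps out of `H¹(K_∞, E[p^∞])`
# (crux `SignedTransportAtTwo`, stmt-BirchSwinnertonDyer-20333, route `ThetaPartnerAtTwo`; lead prover bsd-wall-tp2-p1 g8;
# `--supports`; route-independent, closes nothing)

HONEST FRAMING. THEOREMS ONLY; no definition (the comparison map is produced existentially); BSD is not proved by any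
of this. For a number field `K`, a prime `p`, ANY `ℤ_p`-extension `κ` (`H = ker κ`), a finite place `v ∤ p` with completion
`F = K_v` and an elliptic curve `E/K`:

* `exists_localCurrency_hom` — there is an additive map
  `β : H¹(H ∩ D_v, E[p^∞]) → H¹(Gal(K̄_v/(K_∞)_η), E(K̄_v))` (pull back along `Gal(K̄_v/(K_∞)_η) = res⁻¹(H) → H ∩ D_v`,
  push along `E[p^∞] ↪ E(K̄) → E(K̄_v)`) with
  (i) `β ∘ res^H_{H ∩ D_v} = loc_v` (the tree's `WeierstrassCurve.localResOver`, functoriality of `H¹`);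
  (ii) `β` INJECTIVE — Kummer vanishing at `v ∤ p` (`E((K_∞)_η) ⊗ ℚ_p/ℤ_p = 0`, Greenberg LNM 1716 Prop. 2.1, the tree's
  `Greenberg1999.exists_sub_smul_mem_primaryComponent_fixedPoints_localSubgroup`) and "torsion is algebraic"
  (`torsionPointsEquiv`): a torsion-valued cocycle that bounds in `E(K̄_v)` bounds in `E[p^∞]`;
  (iii) every value of `β` is `p`-power torsion (compactness).

This is the dictionary between the local factor `Y_v = im(H¹(H ∩ D_v, E[p^∞]) → H¹(H ∩ I_v, E[p^∞]))` of line `bridge`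
(GV 2000 §2, `𝓗_v`) and the `𝒫`-currency of the K4 seats' SURJ♯ (`SignedEC.sharp_localRes_surjective_two_of_print4`).

References: [GreenbergVatsal2000] §2 pp. 16–17; [GreenbergLNM1716] §2 Prop. 2.1 (p. 72), §3 p. 85; [SilvermanAEC2009] Cor. III.6.4;
[SerreGaloisCohomology1997] I §2.4, II §1.1.
-/

set_option autoImplicit false
-- D-0017: single-problem summit, so `Summit.BirchSwinnertonDyer.BirchSwinnertonDyer.…` repeats a namespace BY DESIGN.
set_option linter.dupNamespace false

noncomputable section

open scoped Classical

open NumberField IsDedekindDomain Field Function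
open Literature.NumberTheory.GaloisRepresentations Literature.NumberTheory.EllipticCurves
  Literature.NumberTheory.EllipticCurves.GreenbergSelmer WeierstrassCurve

namespace Summit.BirchSwinnertonDyer.BirchSwinnertonDyer.Theorems.SignedTransportAtTwo

universe u

variable {K : Type u} [Field K] [NumberField K] (W : WeierstrassCurve K) [W.IsElliptic]
  {p : ℕ} [hp : Fact p.Prime] (κ : ZpExtension K p)

/-- **The dictionary `Y`-currency → `𝒫`-currency at `v ∤ p`.** For any `ℤ_p`-extension `κ` of the number field `K`
(`H = ker κ`), a finite place `v ∤ p` (`F = K_v`) and an elliptic curve `E/K` there is an additive map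
`β : H¹(H ∩ D_v, E[p^∞]) → H¹(Gal(K̄_v/(K_∞)_η), E(K̄_v))` which (i) intertwines the two localisations out of
`H¹(K_∞, E[p^∞])` (`β ∘ res = localResOver`), (ii) is INJECTIVE (Kummer vanishing `E((K_∞)_η) ⊗ ℚ_p/ℤ_p = 0` at
`η ∤ p`, Greenberg Prop. 2.1, plus algebraicity of torsion), (iii) takes `p`-power-torsion values.
[cite: GreenbergLNM1716, §2 Prop. 2.1 (p. 72)] [cite: GreenbergVatsal2000, §2 pp. 16–17] [cite: SilvermanAEC2009, Cor. III.6.4] -/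
theorem exists_localCurrency_hom (v : HeightOneSpectrum (𝓞 K)) (hpv : ((p : ℕ) : 𝓞 K) ∉ v.asIdeal) :
    ∃ β : discreteH1 (decompIn κ.kerSubgroup v) (W.geomPrimaryTorsion p) →+
        discreteH1 (localSubgroup κ.kerSubgroup (v.adicCompletion K)) (localPoints W (v.adicCompletion K)),
      Injective β ∧
      (∀ c : W.subgroupH1 p κ.kerSubgroup,
        β (resH1Hom (decompInToH κ.kerSubgroup v) (AddMonoidHom.id (W.geomPrimaryTorsion p)) (fun _ _ ↦ rfl) c) =
          W.localResOver p κ.kerSubgroup (v.adicCompletion K) c) ∧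
      ∀ z, ∃ k : ℕ, p ^ k • β z = 0 := by
  -- notation
  let F := v.adicCompletion K
  let G : Type u := absoluteGaloisGroup F
  let H : Subgroup (absoluteGaloisGroup K) := κ.kerSubgroup
  let A := W.geomPrimaryTorsion p
  let Pt : Type u := localPoints W F
  let L : Subgroup G := localSubgroup H F
  haveI : CompactSpace G := absoluteGaloisGroup_compactSpace F
  -- the group map `θ : L → H ∩ D_v` and the coefficient map `ψ : E[p^∞] → E(K̄_v)`
  let θ : L →ₜ* decompIn H v :=
    { toFun := fun τ ↦ ⟨⟨resGal (K := K) F τ, ⟨(τ : G), rfl⟩⟩,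
        (mem_decompIn_iff H v _).2 ((mem_localSubgroup_iff H F (τ : G)).1 τ.2)⟩
      map_one' := Subtype.ext (Subtype.ext (by simp))
      map_mul' := fun x y ↦ Subtype.ext (Subtype.ext (by simp))
      continuous_toFun := by
        refine Continuous.subtype_mk (Continuous.subtype_mk ?_ _) _
        exact (resGal (K := K) F).continuous_toFun.comp continuous_subtype_val }
  have hθ : ∀ τ : L, (((θ τ : decompIn H v) : decomp v) : absoluteGaloisGroup K) = resGal (K := K) F τ :=
    fun _ ↦ rfl
  let ψ : A →+ Pt := (pointsMapOfEmb W (closureEmb (K := K) F)).comp A.subtype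
  have hψ : ∀ m : A, ψ m = pointsMap W F (m : W.geomPoints) := fun _ ↦ rfl
  have hcompat : ∀ (x : L) (m : A), ψ (θ x • m) = x • ψ m := fun x m ↦ by
    simp only [ψ, AddMonoidHom.coe_comp, AddSubgroup.coe_subtype, Function.comp_apply]
    rw [show ((θ x • m : A) : W.geomPoints) = resGal (K := K) F x • (m : W.geomPoints) from rfl]
    exact pointsMapOfEmb_smul W (closureEmb (K := K) F) x m
  refine ⟨resH1Hom θ ψ hcompat, ?_, ?_, ?_⟩
  · -- (ii) injectivity: a torsion-valued cocycle on `H ∩ D_v` that bounds in `E(K̄_v)` bounds in `E[p^∞]`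
    -- `L` is closed in the compact `Γ_F`, hence compact
    have hLc : IsClosed ((L : Subgroup G) : Set G) := by
      have e : ((L : Subgroup G) : Set G) = (fun τ : G ↦ κ (resGal (K := K) F τ)) ⁻¹' {1} := by
        ext τ
        rw [SetLike.mem_coe, mem_localSubgroup_iff, Set.mem_preimage, Set.mem_singleton_iff,
          ZpExtension.mem_kerSubgroup]
      rw [e]
      exact isClosed_singleton.preimage
        ((κ.toContinuousMonoidHom.comp (resGal (K := K) F)).continuous_toFun)
    haveI : CompactSpace L := isCompact_iff_compactSpace.mp hLc.isCompact
    -- `θ` is onto: `D_v` is the image of `Γ_F`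
    have hθsurj : Surjective θ := by
      intro x
      obtain ⟨σ, hσx⟩ := (mem_decomp_iff v _).1 (x : decomp v).2
      have hσL : σ ∈ L := by
        rw [mem_localSubgroup_iff, resGal_eq_absGaloisRestrict, hσx]
        exact (mem_decompIn_iff H v _).1 x.2
      exact ⟨⟨σ, hσL⟩, Subtype.ext (Subtype.ext hσx)⟩
    -- `ψ` is injective and `Γ`-compatible with `ℕ`-multiples
    have hψinj : Injective ψ := (pointsMapOfEmb_injective W (closureEmb (K := K) F)).comp Subtype.val_injective
    have galois_smul_nsmul : ∀ (τ : G) (n : ℕ) (P : Pt), τ • (n • P) = n • (τ • P) :=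
      fun τ n P ↦ map_nsmul (DistribSMul.toAddMonoidHom Pt τ) n P
    have htorA : ∀ m : A, ∃ k : ℕ, p ^ k • m = 0 := fun m ↦ by
      obtain ⟨k, hk⟩ := (AddCommGroup.mem_primaryComponent).1 m.2
      exact ⟨k, Subtype.ext (by rw [AddSubmonoidClass.coe_nsmul, ZeroMemClass.coe_zero]; exact hk)⟩
    refine (injective_iff_map_eq_zero _).2 fun z hz ↦ ?_
    obtain ⟨f, rfl⟩ := oneCocycleClass_surjective _ z
    rw [CocycleCriteria.resH1Hom_oneCocycleClass_eq_zero_iff] at hz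
    obtain ⟨a, ha⟩ := hz
    -- one exponent `p^k` kills the (finitely many) values of `f` on `θ(L) = H ∩ D_v`
    obtain ⟨k, hk⟩ := exists_pow_smul_apply_eq_zero (G := L) (M := Pt)
      (contOneCocycles.pullback θ (resHomOfEquivariant θ ψ hcompat) f).1 (fun τ ↦ by
        obtain ⟨j, hj⟩ := htorA (f.1 (θ τ))
        refine ⟨j, ?_⟩
        rw [contOneCocycles.pullback_apply]
        change p ^ j • ψ (f.1 (θ τ)) = 0
        rw [← map_nsmul, hj, map_zero])
    have hk' : ∀ τ : L, p ^ k • ψ (f.1 (θ τ)) = 0 := fun τ ↦ by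
      have h := hk τ
      rwa [contOneCocycles.pullback_apply] at h
    -- `p^k • a` is fixed by `L`
    set Mi : AddSubgroup Pt := FixedPoints.addSubgroup L Pt with hMi
    have hka : p ^ k • a ∈ Mi := by
      rintro ⟨τ, hτ⟩
      change τ • (p ^ k • a) = p ^ k • a
      have h1 : p ^ k • ((τ : G) • a - a) = 0 := by
        have h := hk' ⟨τ, hτ⟩
        rw [ha ⟨τ, hτ⟩, Subgroup.smul_def] at h
        exact h
      rw [smul_sub, ← galois_smul_nsmul, sub_eq_zero] at h1
      exact h1
    -- KUMMER VANISHING at `v ∤ p`: `p^k a = p^k R + (p-power torsion)` with `R ∈ E((K_∞)_η)`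
    obtain ⟨R, hR⟩ := PrimaryCoinvariants.exists_sub_pow_smul_mem p
      (Greenberg1999.exists_sub_smul_mem_primaryComponent_fixedPoints_localSubgroup W κ v hpv) k ⟨p ^ k • a, hka⟩
    rw [PrimaryCoinvariants.mem_primaryComponent_iff_exists_nsmul] at hR
    obtain ⟨m₁, hm₁⟩ := hR
    have hm₁' : p ^ m₁ • (p ^ k • a - p ^ k • ((R : Mi) : Pt)) = 0 := by
      have h := congrArg (fun z : Mi ↦ (z : Pt)) hm₁
      simpa only [AddSubgroupClass.coe_nsmul, AddSubgroupClass.coe_sub, ZeroMemClass.coe_zero] using h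
    set P' : Pt := a - ((R : Mi) : Pt) with hP'def
    have hP'tors : p ^ (m₁ + k) • P' = 0 := by
      rw [hP'def, pow_add, mul_smul, smul_sub (p ^ k), hm₁']
    have hRfix : ∀ τ : L, (τ : G) • ((R : Mi) : Pt) = ((R : Mi) : Pt) := fun τ ↦ R.2 τ
    have ha' : ∀ τ : L, ψ (f.1 (θ τ)) = (τ : G) • P' - P' := fun τ ↦ by
      rw [ha τ, Subgroup.smul_def, hP'def, smul_sub, hRfix τ]
      abel
    -- torsion is algebraic: `P' = ψ a₀` for some `a₀ ∈ E[p^∞](K̄)`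
    set n : ℤ := ((p ^ (m₁ + k) : ℕ) : ℤ) with hn
    have hn0 : n ≠ 0 := by rw [hn]; exact_mod_cast pow_ne_zero _ hp.out.ne_zero
    have hP'n : P' ∈ AddSubgroup.torsionBy Pt n := by
      change n • P' = 0
      rw [hn, natCast_zsmul]; exact hP'tors
    set a₀g : W.geomTorsion n := (W.torsionPointsEquiv n (E := F) hn0).symm ⟨P', hP'n⟩ with ha₀g
    have ha₀A : (a₀g : W.geomPoints) ∈ W.geomPrimaryTorsion p := by
      refine (AddCommGroup.mem_primaryComponent).2 ⟨m₁ + k, ?_⟩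
      have h : ((p ^ (m₁ + k) : ℕ) : ℤ) • (a₀g : W.geomPoints) = 0 := a₀g.2
      rwa [natCast_zsmul] at h
    set a₀ : A := ⟨(a₀g : W.geomPoints), ha₀A⟩ with ha₀
    have hψa₀ : ψ a₀ = P' := by
      rw [hψ]
      exact W.pointsMap_torsionPointsEquiv_symm n hn0 ⟨P', hP'n⟩
    -- conclude: `f = ∂ a₀` on `H ∩ D_v`
    rw [oneCocycleClass_eq_zero_iff]
    refine ⟨a₀, fun x ↦ ?_⟩
    obtain ⟨τ, rfl⟩ := hθsurj x
    rw [discreteTopRep_ρ_apply]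
    apply hψinj
    change ψ (f.1 (θ τ)) = ψ (θ τ • a₀ - a₀)
    rw [map_sub, hcompat, hψa₀]
    exact ha' τ
  · -- (i) compatibility with `localResOver`
    intro c
    have h := congrArg (fun f ↦ f c) (resH1Hom_comp (decompInToH H v) (AddMonoidHom.id A) (fun _ _ ↦ rfl) θ ψ hcompat)
    simp only [AddMonoidHom.coe_comp, Function.comp_apply] at h
    rw [h]
    exact DFunLike.congr_fun (resH1Hom_congr rfl (AddMonoidHom.ext fun _ ↦ rfl) _ _) c
  · -- (iii) torsion values: one power of `p` kills the finitely many values of a cocycle on the compact `L`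
    intro z
    have hLc : IsClosed ((L : Subgroup G) : Set G) := by
      have e : ((L : Subgroup G) : Set G) = (fun τ : G ↦ κ (resGal (K := K) F τ)) ⁻¹' {1} := by
        ext τ
        rw [SetLike.mem_coe, mem_localSubgroup_iff, Set.mem_preimage, Set.mem_singleton_iff,
          ZpExtension.mem_kerSubgroup]
      rw [e]
      exact isClosed_singleton.preimage
        ((κ.toContinuousMonoidHom.comp (resGal (K := K) F)).continuous_toFun)
    haveI : CompactSpace L := isCompact_iff_compactSpace.mp hLc.isCompact
    have htorA : ∀ m : A, ∃ k : ℕ, p ^ k • m = 0 := fun m ↦ by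
      obtain ⟨k, hk⟩ := (AddCommGroup.mem_primaryComponent).1 m.2
      exact ⟨k, Subtype.ext (by rw [AddSubmonoidClass.coe_nsmul, ZeroMemClass.coe_zero]; exact hk)⟩
    obtain ⟨f, rfl⟩ := oneCocycleClass_surjective _ z
    have e1 : resH1Hom θ ψ hcompat (oneCocycleClass _ f) =
        oneCocycleClass _ (contOneCocycles.pullback θ (resHomOfEquivariant θ ψ hcompat) f) :=
      map_oneCocycleClass _ _ _ f
    obtain ⟨k, hk⟩ := exists_pow_smul_apply_eq_zero (G := L) (M := Pt)
      (contOneCocycles.pullback θ (resHomOfEquivariant θ ψ hcompat) f).1 (fun τ ↦ by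
        obtain ⟨j, hj⟩ := htorA (f.1 (θ τ))
        refine ⟨j, ?_⟩
        rw [contOneCocycles.pullback_apply]
        change p ^ j • ψ (f.1 (θ τ)) = 0
        rw [← map_nsmul, hj, map_zero])
    refine ⟨k, ?_⟩
    have hb0 : p ^ k • contOneCocycles.pullback θ (resHomOfEquivariant θ ψ hcompat) f = 0 :=
      Subtype.ext (by ext τ; exact hk τ)
    rw [e1, ← oneCocycleClassₗ_apply, ← map_nsmul, hb0, map_zero]

end Summit.BirchSwinnertonDyer.BirchSwinnertonDyer.Theorems.SignedTransportAtTwo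

end
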